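import Mathlib
import Summits.QuantumAdvantage.QuantumAdvantage.Theorems.MobiusLadderQuadraticDigitPhasesStubWordDecayOfUWC
import Summits.QuantumAdvantage.QuantumAdvantage.Theorems.MobiusLadderQuadraticDigitPhasesStubUwcOfNoExact
import Summits.QuantumAdvantage.QuantumAdvantage.Theorems.MobiusLadderQuadraticDigitPhasesStubL1Strict
import Summits.QuantumAdvantage.QuantumAdvantage.Theorems.MobiusLadderQuadraticDigitPhasesStubGridReach

/-!
# No exact twisted cycle, part A: exactness toolkit and support spreading

Lemmas for the lead's stub `stub_noExactTwistedCycle` of the crux `MobiusLadder.QuadraticDigitPhases`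
(stmt-QuantumAdvantage-1391), line `Sketch`.

Setting: the pair-carry chain of `T ↦ (pT, qT)` on `Fin p × Fin q`; a digit `t ∈ {0,1}` moves
`x = (r, r') ↦ (⌊(pt + r)/2⌋, ⌊(qt + r')/2⌋)` with weight `1/2`, the letter `M_{ab}` twists the move by
the output bits.  Row vectors are contracted in `ℓ¹` by every letter.  A step `v ↦ v A` is EXACT when
`‖v A‖₁ = ‖v‖₁`.

Contents:
* generic consequences of exactness (from the strictness lemma `stub_l1Strict`): no discordant merge
  (`noCancel`), a charged state charges its targets (`apply_ne_zero`), exactness of a word passes to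
  its pieces (`exact_cons`, `exact_append`), strict loss anywhere is strict loss overall
  (`lt_of_head`, `lt_of_tail`);
* the entries of the letters (`letter_entry`): `M_{ab} x y = ½ ε` at the two digit targets, which are
  distinct;
* SUPPORT SPREADING (`charge_spread`): along an exact plain word of length `k` read from a charged
  reachable state `(⌊pT/2^c⌋, ⌊qT/2^c⌋)`, every state `(⌊pT'/2^{c+k}⌋, ⌊qT'/2^{c+k}⌋)`, `T' = T + 2^c w`,
  gets charged; with `stub_gridReach` (`2^k ≥ pq`) the charge fills every carry cell
  (`full_of_exact_plain`), where the cells are the `(r, r')` with `r q < (r'+1) p ∧ r' p < (r+1) q`;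
* reachable states are cells (`cell_of_reach`) and, via the stationary vector, cells are reachable
  (`reach_of_cell`).
-/

set_option linter.dupNamespace false -- D-0017: single-problem summit ⇒ `QuantumAdvantage.QuantumAdvantage` by design

namespace Summit.QuantumAdvantage.QuantumAdvantage.Theorems.MobiusLadderQuadraticDigitPhasesStubNoExactA

open Finset
open scoped Matrix
open Summit.QuantumAdvantage.QuantumAdvantage.Theorems.MobiusLadderQuadraticDigitPhasesStubL1Strict
  (stub_l1Strict)
open Summit.QuantumAdvantage.QuantumAdvantage.Theorems.MobiusLadderQuadraticDigitPhasesStubUwcOfNoExact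
  (l1_vecMul_le l1_mul_prod_le supp_vecMul)
open Summit.QuantumAdvantage.QuantumAdvantage.Theorems.MobiusLadderQuadraticDigitPhasesStubWordDecayOfUWC
  (sum_abs_letter_le abs_twist reach_step support_vecMul_prod)
open Summit.QuantumAdvantage.QuantumAdvantage.Theorems.MobiusLadderQuadraticDigitPhasesStubGridReach
  (stub_gridReach)

/-! ## Generic consequences of exactness -/

/-- Exactness `‖v A‖₁ = ‖v‖₁` forbids discordant merges: the contributions of two distinct states to
one target never have opposite strict signs. -/
theorem noCancel {ι : Type} [Fintype ι] (A : Matrix ι ι ℝ) (hA : ∀ s, ∑ z, |A s z| ≤ 1)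
    (v : ι → ℝ) (hex : ∑ z, |(v ᵥ* A) z| = ∑ s, |v s|) (y x x' : ι) (hxx' : x ≠ x') :
    0 ≤ v x * A x y * (v x' * A x' y) := by
  by_contra h
  exact absurd hex (stub_l1Strict ι A v y x x' hA hxx' (lt_of_not_ge h)).ne

/-- Under exactness a charged state charges its targets: `v x * A x y ≠ 0 ⇒ (v A) y ≠ 0`. -/
theorem apply_ne_zero {ι : Type} [Fintype ι] [DecidableEq ι] (A : Matrix ι ι ℝ)
    (hA : ∀ s, ∑ z, |A s z| ≤ 1) (v : ι → ℝ) (hex : ∑ z, |(v ᵥ* A) z| = ∑ s, |v s|)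
    (y x : ι) (hx : v x * A x y ≠ 0) : (v ᵥ* A) y ≠ 0 := by
  intro h0
  have hsum : ∑ s, v s * A s y = 0 := h0
  have h2 : ∑ s, v x * A x y * (v s * A s y) = 0 := by
    rw [← Finset.mul_sum, hsum, mul_zero]
  have h3 := Finset.add_sum_erase univ (fun s => v x * A x y * (v s * A s y)) (mem_univ x)
  rw [h2] at h3
  have hpos : 0 < v x * A x y * (v x * A x y) := mul_self_pos.2 hx
  have h4 : ∑ s ∈ univ.erase x, v x * A x y * (v s * A s y) < ∑ _s ∈ univ.erase x, (0 : ℝ) := by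
    rw [Finset.sum_const_zero]
    linarith
  obtain ⟨x', hx', hlt⟩ := Finset.exists_lt_of_sum_lt h4
  exact absurd (noCancel A hA v hex y x x' (ne_of_mem_erase hx').symm) (not_le.2 hlt)

/-- Exactness of a word forces exactness of its first letter and of the remaining word. -/
theorem exact_cons {ι : Type} [Fintype ι] [DecidableEq ι] {L : Type*} (Λ : L → Matrix ι ι ℝ)
    (hΛ : ∀ l s, ∑ z, |Λ l s z| ≤ 1) (v : ι → ℝ) (l : L) (W : List L)
    (hex : ∑ z, |(v ᵥ* ((l :: W).map Λ).prod) z| = ∑ s, |v s|) :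
    ∑ z, |(v ᵥ* Λ l) z| = ∑ s, |v s| ∧
      ∑ z, |((v ᵥ* Λ l) ᵥ* (W.map Λ).prod) z| = ∑ z, |(v ᵥ* Λ l) z| := by
  rw [List.map_cons, List.prod_cons, ← Matrix.vecMul_vecMul] at hex
  have h1 := l1_mul_prod_le Λ hΛ W (v ᵥ* Λ l)
  have h2 := l1_vecMul_le (Λ l) (hΛ l) v
  constructor <;> linarith

/-- Exactness of a concatenated word forces exactness of both pieces. -/
theorem exact_append {ι : Type} [Fintype ι] [DecidableEq ι] {L : Type*} (Λ : L → Matrix ι ι ℝ)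
    (hΛ : ∀ l s, ∑ z, |Λ l s z| ≤ 1) (v : ι → ℝ) (X Z : List L)
    (hex : ∑ z, |(v ᵥ* ((X ++ Z).map Λ).prod) z| = ∑ s, |v s|) :
    ∑ z, |(v ᵥ* (X.map Λ).prod) z| = ∑ s, |v s| ∧
      ∑ z, |((v ᵥ* (X.map Λ).prod) ᵥ* (Z.map Λ).prod) z| = ∑ z, |(v ᵥ* (X.map Λ).prod) z| := by
  rw [List.map_append, List.prod_append, ← Matrix.vecMul_vecMul] at hex
  have h1 := l1_mul_prod_le Λ hΛ Z (v ᵥ* (X.map Λ).prod)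
  have h2 := l1_mul_prod_le Λ hΛ X v
  constructor <;> linarith

/-- A strict loss on the first piece of a word is a strict loss for the whole word. -/
theorem lt_of_head {ι : Type} [Fintype ι] [DecidableEq ι] {L : Type*} (Λ : L → Matrix ι ι ℝ)
    (hΛ : ∀ l s, ∑ z, |Λ l s z| ≤ 1) (v : ι → ℝ) (X Z : List L)
    (h : ∑ z, |(v ᵥ* (X.map Λ).prod) z| < ∑ s, |v s|) :
    ∑ z, |(v ᵥ* ((X ++ Z).map Λ).prod) z| < ∑ s, |v s| := by
  rw [List.map_append, List.prod_append, ← Matrix.vecMul_vecMul]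
  exact (l1_mul_prod_le Λ hΛ Z _).trans_lt h

/-- A strict loss on the second piece of a word is a strict loss for the whole word. -/
theorem lt_of_tail {ι : Type} [Fintype ι] [DecidableEq ι] {L : Type*} (Λ : L → Matrix ι ι ℝ)
    (hΛ : ∀ l s, ∑ z, |Λ l s z| ≤ 1) (v : ι → ℝ) (X Z : List L)
    (h : ∑ z, |((v ᵥ* (X.map Λ).prod) ᵥ* (Z.map Λ).prod) z| < ∑ z, |(v ᵥ* (X.map Λ).prod) z|) :
    ∑ z, |(v ᵥ* ((X ++ Z).map Λ).prod) z| < ∑ s, |v s| := by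
  rw [List.map_append, List.prod_append, ← Matrix.vecMul_vecMul]
  exact h.trans_le (l1_mul_prod_le Λ hΛ X v)

/-! ## The letters of the pair-carry chain -/

section Chain

variable {p q : ℕ}

/-- A digit target coordinate stays in range: `⌊(pt + r)/2⌋ < p` for `r < p`, `t ≤ 1`. -/
theorem succ_lt {n r t : ℕ} (hr : r < n) (ht : t ≤ 1) : (n * t + r) / 2 < n := by
  have h : n * t ≤ n := by simpa using Nat.mul_le_mul_left n ht
  generalize n * t = m at h ⊢
  omega

/-- The two digit targets of a state differ (in the first coordinate), since `p ≥ 2`. -/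
theorem targets_ne (hp : 2 ≤ p) (r : ℕ) : (p * 0 + r) / 2 ≠ (p * 1 + r) / 2 := by
  omega

/-- A twist product `ε = (±1)·(±1)` squares to `1`. -/
theorem twist_mul_self (a b : Bool) (m n : ℕ) :
    (if a then (-1 : ℝ) ^ m else 1) * (if b then (-1 : ℝ) ^ n else 1) *
      ((if a then (-1 : ℝ) ^ m else 1) * (if b then (-1 : ℝ) ^ n else 1)) = 1 := by
  rw [← abs_mul_abs_self, abs_mul, abs_twist, abs_twist]
  norm_num

/-- A twist product is nonzero. -/
theorem twist_ne_zero (a b : Bool) (m n : ℕ) :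
    (if a then (-1 : ℝ) ^ m else 1) * (if b then (-1 : ℝ) ^ n else 1) ≠ 0 := by
  intro h
  have := twist_mul_self a b m n
  rw [h, zero_mul] at this
  exact zero_ne_one this

-- adapted from …Theorems.MobiusLadderQuadraticDigitPhasesStubDwdOfWords.carry_succ (= it; kept private here, as in
-- …StubWordDecayOfUWC / …StubUwcOfNoExact, to avoid importing the OneCutKatai chain)
/-- One digit move keeps carries of the shape `⌊p T/2^c⌋`:
`⌊p (2^c t + T) / 2^{c+1}⌋ = ⌊(p t + ⌊p T/2^c⌋)/2⌋`. -/
private theorem carry_step (p c t T : ℕ) :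
    p * (2 ^ c * t + T) / 2 ^ (c + 1) = (p * t + p * T / 2 ^ c) / 2 := by
  rw [pow_succ, ← Nat.div_div_eq_div_mul, show p * (2 ^ c * t + T) = p * T + p * t * 2 ^ c by ring,
    Nat.add_mul_div_right _ _ (Nat.two_pow_pos c), add_comm]

/-- ENTRY FORMULA: at the digit-`t` target of `x` the letter `M_{ab}` has the entry `½ ε_{ab}(x,t)`
(the other digit's target is a different state, `targets_ne`). -/
theorem letter_entry (hp : 2 ≤ p) (M : Bool × Bool → Matrix (Fin p × Fin q) (Fin p × Fin q) ℝ)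
    (hM : M = fun ab : Bool × Bool => (Matrix.of fun (x y : Fin p × Fin q) =>
      ∑ t ∈ ({0, 1} : Finset ℕ),
        if (y.1 : ℕ) = (p * t + x.1) / 2 ∧ (y.2 : ℕ) = (q * t + x.2) / 2 then
          (1 / 2 : ℝ) * (if ab.1 then (-1 : ℝ) ^ ((p * t + x.1) % 2) else 1) *
            (if ab.2 then (-1 : ℝ) ^ ((q * t + x.2) % 2) else 1)
        else 0))
    (ab : Bool × Bool) (x y : Fin p × Fin q) (t : ℕ) (ht : t ≤ 1)
    (hy : (y.1 : ℕ) = (p * t + x.1) / 2 ∧ (y.2 : ℕ) = (q * t + x.2) / 2) :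
    M ab x y = 1 / 2 * ((if ab.1 then (-1 : ℝ) ^ ((p * t + x.1) % 2) else 1) *
      (if ab.2 then (-1 : ℝ) ^ ((q * t + x.2) % 2) else 1)) := by
  subst hM
  simp only [Matrix.of_apply]
  rw [Finset.sum_pair (by norm_num : (0 : ℕ) ≠ 1)]
  have hne := targets_ne hp (x.1 : ℕ)
  rcases Nat.le_one_iff_eq_zero_or_eq_one.mp ht with rfl | rfl
  · have h1 : ¬ ((y.1 : ℕ) = (p * 1 + x.1) / 2 ∧ (y.2 : ℕ) = (q * 1 + x.2) / 2) :=
      fun h => hne (hy.1.symm.trans h.1)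
    rw [if_pos hy, if_neg h1, add_zero, mul_assoc]
  · have h0 : ¬ ((y.1 : ℕ) = (p * 0 + x.1) / 2 ∧ (y.2 : ℕ) = (q * 0 + x.2) / 2) :=
      fun h => hne (h.1.symm.trans hy.1)
    rw [if_neg h0, if_pos hy, zero_add, mul_assoc]

/-- Off the two digit targets the letter entries vanish. -/
theorem letter_entry_zero (M : Bool × Bool → Matrix (Fin p × Fin q) (Fin p × Fin q) ℝ)
    (hM : M = fun ab : Bool × Bool => (Matrix.of fun (x y : Fin p × Fin q) =>
      ∑ t ∈ ({0, 1} : Finset ℕ),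
        if (y.1 : ℕ) = (p * t + x.1) / 2 ∧ (y.2 : ℕ) = (q * t + x.2) / 2 then
          (1 / 2 : ℝ) * (if ab.1 then (-1 : ℝ) ^ ((p * t + x.1) % 2) else 1) *
            (if ab.2 then (-1 : ℝ) ^ ((q * t + x.2) % 2) else 1)
        else 0))
    (ab : Bool × Bool) (x y : Fin p × Fin q)
    (h : ∀ t : ℕ, t ≤ 1 → ¬ ((y.1 : ℕ) = (p * t + x.1) / 2 ∧ (y.2 : ℕ) = (q * t + x.2) / 2)) :
    M ab x y = 0 := by
  subst hM
  simp only [Matrix.of_apply]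
  rw [Finset.sum_pair (by norm_num : (0 : ℕ) ≠ 1), if_neg (h 0 (Nat.zero_le 1)), if_neg (h 1 le_rfl),
    add_zero]

/-- A charged state charges its digit-`t` target under an exact letter. -/
theorem target_ne_zero (hp : 2 ≤ p) (M : Bool × Bool → Matrix (Fin p × Fin q) (Fin p × Fin q) ℝ)
    (hM : M = fun ab : Bool × Bool => (Matrix.of fun (x y : Fin p × Fin q) =>
      ∑ t ∈ ({0, 1} : Finset ℕ),
        if (y.1 : ℕ) = (p * t + x.1) / 2 ∧ (y.2 : ℕ) = (q * t + x.2) / 2 then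
          (1 / 2 : ℝ) * (if ab.1 then (-1 : ℝ) ^ ((p * t + x.1) % 2) else 1) *
            (if ab.2 then (-1 : ℝ) ^ ((q * t + x.2) % 2) else 1)
        else 0))
    (ab : Bool × Bool) (v : Fin p × Fin q → ℝ) (hex : ∑ z, |(v ᵥ* M ab) z| = ∑ s, |v s|)
    (x y : Fin p × Fin q) (hvx : v x ≠ 0) (t : ℕ) (ht : t ≤ 1)
    (hy : (y.1 : ℕ) = (p * t + x.1) / 2 ∧ (y.2 : ℕ) = (q * t + x.2) / 2) :
    (v ᵥ* M ab) y ≠ 0 := by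
  classical
  refine apply_ne_zero (M ab) (sum_abs_letter_le M hM ab) v hex y x (mul_ne_zero hvx ?_)
  rw [letter_entry hp M hM ab x y t ht hy]
  exact mul_ne_zero (by norm_num) (twist_ne_zero _ _ _ _)

/-- SUPPORT SPREADING.  Along an exact plain word `X` read from a vector charging the reachable state
`(⌊pT/2^c⌋, ⌊qT/2^c⌋)`, every state `(⌊p(T + 2^c w)/2^{c+|X|}⌋, ⌊q(T + 2^c w)/2^{c+|X|}⌋)`, `w < 2^{|X|}`,
is charged at the end. -/
theorem charge_spread (hp : 2 ≤ p) (M : Bool × Bool → Matrix (Fin p × Fin q) (Fin p × Fin q) ℝ)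
    (hM : M = fun ab : Bool × Bool => (Matrix.of fun (x y : Fin p × Fin q) =>
      ∑ t ∈ ({0, 1} : Finset ℕ),
        if (y.1 : ℕ) = (p * t + x.1) / 2 ∧ (y.2 : ℕ) = (q * t + x.2) / 2 then
          (1 / 2 : ℝ) * (if ab.1 then (-1 : ℝ) ^ ((p * t + x.1) % 2) else 1) *
            (if ab.2 then (-1 : ℝ) ^ ((q * t + x.2) % 2) else 1)
        else 0)) :
    ∀ (X : List (Bool × Bool)) (v : Fin p × Fin q → ℝ) (c T : ℕ), T < 2 ^ c →
      ∑ z, |(v ᵥ* (X.map M).prod) z| = ∑ s, |v s| →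
      (∃ x : Fin p × Fin q, (x.1 : ℕ) = p * T / 2 ^ c ∧ (x.2 : ℕ) = q * T / 2 ^ c ∧ v x ≠ 0) →
      ∀ w : ℕ, w < 2 ^ X.length →
        ∃ y : Fin p × Fin q, (y.1 : ℕ) = p * (T + 2 ^ c * w) / 2 ^ (c + X.length) ∧
          (y.2 : ℕ) = q * (T + 2 ^ c * w) / 2 ^ (c + X.length) ∧ (v ᵥ* (X.map M).prod) y ≠ 0 := by
  classical
  intro X
  induction X with
  | nil =>
    intro v c T _ _ hx w hw
    obtain ⟨x, hx1, hx2, hvx⟩ := hx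
    have hw0 : w = 0 := by simpa using hw
    subst hw0
    refine ⟨x, ?_, ?_, ?_⟩
    · simpa using hx1
    · simpa using hx2
    · simpa using hvx
  | cons ab X ih =>
    intro v c T hT hex hx w hw
    obtain ⟨x, hx1, hx2, hvx⟩ := hx
    obtain ⟨hex1, hex2⟩ := exact_cons M (sum_abs_letter_le M hM) v ab X hex
    obtain ⟨t, w', ht, rfl⟩ : ∃ t w' : ℕ, t ≤ 1 ∧ w = t + 2 * w' := ⟨w % 2, w / 2, by omega, by omega⟩
    have hw' : w' < 2 ^ X.length := by
      rw [List.length_cons, pow_succ] at hw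
      omega
    -- the digit-`t` target of `x`
    set y₀ : Fin p × Fin q :=
      (⟨(p * t + x.1) / 2, succ_lt x.1.isLt ht⟩, ⟨(q * t + x.2) / 2, succ_lt x.2.isLt ht⟩) with hy₀
    have hy₀c : (y₀.1 : ℕ) = (p * t + x.1) / 2 ∧ (y₀.2 : ℕ) = (q * t + x.2) / 2 := ⟨rfl, rfl⟩
    have h1 : (v ᵥ* M ab) y₀ ≠ 0 := target_ne_zero hp M hM ab v hex1 x y₀ hvx t ht hy₀c
    have hT' : T + 2 ^ c * t < 2 ^ (c + 1) := by
      have : 2 ^ c * t ≤ 2 ^ c := by simpa using Nat.mul_le_mul_left (2 ^ c) ht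
      rw [pow_succ]
      omega
    have hc1 : (y₀.1 : ℕ) = p * (T + 2 ^ c * t) / 2 ^ (c + 1) := by
      rw [hy₀c.1, hx1, add_comm T, carry_step]
    have hc2 : (y₀.2 : ℕ) = q * (T + 2 ^ c * t) / 2 ^ (c + 1) := by
      rw [hy₀c.2, hx2, add_comm T, carry_step]
    obtain ⟨y, hy1, hy2, hyv⟩ :=
      ih (v ᵥ* M ab) (c + 1) (T + 2 ^ c * t) hT' hex2 ⟨y₀, hc1, hc2, h1⟩ w' hw'
    have e1 : T + 2 ^ c * t + 2 ^ (c + 1) * w' = T + 2 ^ c * (t + 2 * w') := by ring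
    have e2 : c + 1 + X.length = c + (ab :: X).length := by
      rw [List.length_cons]; ring
    refine ⟨y, ?_, ?_, ?_⟩
    · rw [hy1, e1, e2]
    · rw [hy2, e1, e2]
    · rw [List.map_cons, List.prod_cons, ← Matrix.vecMul_vecMul]
      exact hyv

/-- FULL SUPPORT.  An exact plain word of length `k` with `2^k ≥ pq`, read from a vector charging a
reachable state, charges every carry cell. -/
theorem full_of_exact_plain (hp : p.Prime) (hq : q.Prime) (hpq : p ≠ q) (hp2 : 2 < p) (hq2 : 2 < q)
    (M : Bool × Bool → Matrix (Fin p × Fin q) (Fin p × Fin q) ℝ)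
    (hM : M = fun ab : Bool × Bool => (Matrix.of fun (x y : Fin p × Fin q) =>
      ∑ t ∈ ({0, 1} : Finset ℕ),
        if (y.1 : ℕ) = (p * t + x.1) / 2 ∧ (y.2 : ℕ) = (q * t + x.2) / 2 then
          (1 / 2 : ℝ) * (if ab.1 then (-1 : ℝ) ^ ((p * t + x.1) % 2) else 1) *
            (if ab.2 then (-1 : ℝ) ^ ((q * t + x.2) % 2) else 1)
        else 0))
    (X : List (Bool × Bool)) (hX : p * q ≤ 2 ^ X.length) (v : Fin p × Fin q → ℝ) (c T : ℕ)
    (hT : T < 2 ^ c) (hex : ∑ z, |(v ᵥ* (X.map M).prod) z| = ∑ s, |v s|)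
    (hx : ∃ x : Fin p × Fin q, (x.1 : ℕ) = p * T / 2 ^ c ∧ (x.2 : ℕ) = q * T / 2 ^ c ∧ v x ≠ 0)
    (y : Fin p × Fin q)
    (hy : (y.1 : ℕ) * q < ((y.2 : ℕ) + 1) * p ∧ (y.2 : ℕ) * p < ((y.1 : ℕ) + 1) * q) :
    (v ᵥ* (X.map M).prod) y ≠ 0 := by
  obtain ⟨w, hw, hw1, hw2⟩ := stub_gridReach p q hp hq hpq hp2 hq2 y.1 y.2 c T X.length y.1.isLt
    y.2.isLt hy.1 hy.2 hT hX
  obtain ⟨y', hy'1, hy'2, hv⟩ := charge_spread hp.two_le M hM X v c T hT hex hx w hw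
  have : y' = y :=
    Prod.ext (Fin.ext (by rw [hy'1, hw1])) (Fin.ext (by rw [hy'2, hw2]))
  exact this ▸ hv

/-- Reachable states `(⌊pT/2^c⌋, ⌊qT/2^c⌋)` are carry cells. -/
theorem cell_of_reach (hp : 0 < p) (hq : 0 < q) (s : Fin p × Fin q)
    (hs : ∃ c T : ℕ, T < 2 ^ c ∧ (s.1 : ℕ) = p * T / 2 ^ c ∧ (s.2 : ℕ) = q * T / 2 ^ c) :
    (s.1 : ℕ) * q < ((s.2 : ℕ) + 1) * p ∧ (s.2 : ℕ) * p < ((s.1 : ℕ) + 1) * q := by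
  obtain ⟨c, T, _, h1, h2⟩ := hs
  have hc : 0 < 2 ^ c := Nat.two_pow_pos c
  have a1 : (s.1 : ℕ) * 2 ^ c ≤ p * T := by rw [h1]; exact Nat.div_mul_le_self _ _
  have a2 : q * T < ((s.2 : ℕ) + 1) * 2 ^ c := by
    rw [h2, add_mul, one_mul]; exact Nat.lt_div_mul_add hc
  have b1 : (s.2 : ℕ) * 2 ^ c ≤ q * T := by rw [h2]; exact Nat.div_mul_le_self _ _
  have b2 : p * T < ((s.1 : ℕ) + 1) * 2 ^ c := by
    rw [h1, add_mul, one_mul]; exact Nat.lt_div_mul_add hc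
  constructor
  · refine Nat.lt_of_mul_lt_mul_right (a := 2 ^ c) ?_
    calc (s.1 : ℕ) * q * 2 ^ c = q * ((s.1 : ℕ) * 2 ^ c) := by ring
      _ ≤ q * (p * T) := Nat.mul_le_mul_left q a1
      _ = p * (q * T) := by ring
      _ < p * (((s.2 : ℕ) + 1) * 2 ^ c) := Nat.mul_lt_mul_of_pos_left a2 hp
      _ = ((s.2 : ℕ) + 1) * p * 2 ^ c := by ring
  · refine Nat.lt_of_mul_lt_mul_right (a := 2 ^ c) ?_
    calc (s.2 : ℕ) * p * 2 ^ c = p * ((s.2 : ℕ) * 2 ^ c) := by ring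
      _ ≤ p * (q * T) := Nat.mul_le_mul_left p b1
      _ = q * (p * T) := by ring
      _ < q * (((s.1 : ℕ) + 1) * 2 ^ c) := Nat.mul_lt_mul_of_pos_left b2 hq
      _ = ((s.1 : ℕ) + 1) * q * 2 ^ c := by ring

/-- The untwisted letter fixes the stationary vector, hence so does every untwisted plain word. -/
theorem stationary_replicate (M : Bool × Bool → Matrix (Fin p × Fin q) (Fin p × Fin q) ℝ)
    (hM : M = fun ab : Bool × Bool => (Matrix.of fun (x y : Fin p × Fin q) =>
      ∑ t ∈ ({0, 1} : Finset ℕ),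
        if (y.1 : ℕ) = (p * t + x.1) / 2 ∧ (y.2 : ℕ) = (q * t + x.2) / 2 then
          (1 / 2 : ℝ) * (if ab.1 then (-1 : ℝ) ^ ((p * t + x.1) % 2) else 1) *
            (if ab.2 then (-1 : ℝ) ^ ((q * t + x.2) % 2) else 1)
        else 0))
    (π : Fin p × Fin q → ℝ)
    (hπinv : ∀ y : Fin p × Fin q, ∑ x : Fin p × Fin q, π x * (Matrix.of fun (x y : Fin p × Fin q) =>
      ∑ t ∈ ({0, 1} : Finset ℕ),
        if (y.1 : ℕ) = (p * t + x.1) / 2 ∧ (y.2 : ℕ) = (q * t + x.2) / 2 then (1 / 2 : ℝ) else 0) x y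
        = π y) :
    ∀ n : ℕ, π ᵥ* ((List.replicate n (false, false)).map M).prod = π := by
  have hfix : π ᵥ* M (false, false) = π := by
    funext y
    rw [← hπinv y]
    simp only [Matrix.vecMul, dotProduct, hM, Matrix.of_apply, Bool.false_eq_true, if_false, mul_one]
  intro n
  induction n with
  | zero => simp
  | succ n ih =>
    rw [List.replicate_succ, List.map_cons, List.prod_cons, ← Matrix.vecMul_vecMul, hfix, ih]

/-- Cells are reachable: the stationary vector is positive exactly on the reachable states, is fixed by
the untwisted word of length `pq`, and charges `(0,0)`; so by `full_of_exact_plain` it charges every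
cell. -/
theorem reach_of_cell (hp : p.Prime) (hq : q.Prime) (hpq : p ≠ q) (hp2 : 2 < p) (hq2 : 2 < q)
    (M : Bool × Bool → Matrix (Fin p × Fin q) (Fin p × Fin q) ℝ)
    (hM : M = fun ab : Bool × Bool => (Matrix.of fun (x y : Fin p × Fin q) =>
      ∑ t ∈ ({0, 1} : Finset ℕ),
        if (y.1 : ℕ) = (p * t + x.1) / 2 ∧ (y.2 : ℕ) = (q * t + x.2) / 2 then
          (1 / 2 : ℝ) * (if ab.1 then (-1 : ℝ) ^ ((p * t + x.1) % 2) else 1) *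
            (if ab.2 then (-1 : ℝ) ^ ((q * t + x.2) % 2) else 1)
        else 0))
    (π : Fin p × Fin q → ℝ)
    (hπpos : ∀ s : Fin p × Fin q,
      (∃ c T : ℕ, T < 2 ^ c ∧ (s.1 : ℕ) = p * T / 2 ^ c ∧ (s.2 : ℕ) = q * T / 2 ^ c) → 0 < π s)
    (hπzero : ∀ s : Fin p × Fin q,
      ¬ (∃ c T : ℕ, T < 2 ^ c ∧ (s.1 : ℕ) = p * T / 2 ^ c ∧ (s.2 : ℕ) = q * T / 2 ^ c) → π s = 0)
    (hπinv : ∀ y : Fin p × Fin q, ∑ x : Fin p × Fin q, π x * (Matrix.of fun (x y : Fin p × Fin q) =>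
      ∑ t ∈ ({0, 1} : Finset ℕ),
        if (y.1 : ℕ) = (p * t + x.1) / 2 ∧ (y.2 : ℕ) = (q * t + x.2) / 2 then (1 / 2 : ℝ) else 0) x y
        = π y)
    (y : Fin p × Fin q)
    (hy : (y.1 : ℕ) * q < ((y.2 : ℕ) + 1) * p ∧ (y.2 : ℕ) * p < ((y.1 : ℕ) + 1) * q) :
    ∃ c T : ℕ, T < 2 ^ c ∧ (y.1 : ℕ) = p * T / 2 ^ c ∧ (y.2 : ℕ) = q * T / 2 ^ c := by
  by_contra hny
  have h0 := hπzero y hny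
  set X : List (Bool × Bool) := List.replicate (p * q) (false, false) with hXdef
  have hX : p * q ≤ 2 ^ X.length := by
    rw [hXdef, List.length_replicate]; exact Nat.lt_two_pow_self.le
  have hfixX : π ᵥ* (X.map M).prod = π := stationary_replicate M hM π hπinv (p * q)
  have ho : ∃ c T : ℕ, T < 2 ^ c ∧ (((⟨0, hp.pos⟩, ⟨0, hq.pos⟩) : Fin p × Fin q).1 : ℕ) = p * T / 2 ^ c ∧
      (((⟨0, hp.pos⟩, ⟨0, hq.pos⟩) : Fin p × Fin q).2 : ℕ) = q * T / 2 ^ c :=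
    ⟨0, 0, by norm_num, by simp, by simp⟩
  have key := full_of_exact_plain hp hq hpq hp2 hq2 M hM X hX π 0 0 (by norm_num) (by rw [hfixX])
    ⟨(⟨0, hp.pos⟩, ⟨0, hq.pos⟩), by simp, by simp, (hπpos _ ho).ne'⟩ y hy
  rw [hfixX] at key
  exact key h0

end Chain

/-- CHARGE FILLS THE CELLS (registered sub-goal `stub_chargeFill` of `stub_noExactTwistedCycle`, the
letters written out): `full_of_exact_plain`. -/
theorem stub_chargeFill :
    ∀ p q : ℕ, p.Prime → q.Prime → p ≠ q → 2 < p → 2 < q → ∀ X : List (Bool × Bool), p * q ≤ 2 ^ X.length → ∀ v : Fin p × Fin q → ℝ, ∀ c T : ℕ, T < 2 ^ c → ∑ z : Fin p × Fin q, |Matrix.vecMul v (X.map (fun ab : Bool × Bool => (Matrix.of fun (x y : Fin p × Fin q) => ∑ t ∈ ({0, 1} : Finset ℕ), if (y.1 : ℕ) = (p * t + x.1) / 2 ∧ (y.2 : ℕ) = (q * t + x.2) / 2 then (1 / 2 : ℝ) * (if ab.1 then (-1 : ℝ) ^ ((p * t + x.1) % 2) else 1) * (if ab.2 then (-1 : ℝ)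 ^ ((q * t + x.2) % 2) else 1) else 0))).prod z| = ∑ z : Fin p × Fin q, |v z| → (∃ x : Fin p × Fin q, (x.1 : ℕ) = p * T / 2 ^ c ∧ (x.2 : ℕ) = q * T / 2 ^ c ∧ v x ≠ 0) → ∀ y : Fin p × Fin q, (y.1 : ℕ) * q < ((y.2 : ℕ) + 1) * p ∧ (y.2 : ℕ) * p < ((y.1 : ℕ) + 1) * q → Matrix.vecMul v (X.map (fun ab : Bool × Bool => (Matrix.of fun (x y : Fin p × Fin q) => ∑ t ∈ ({0, 1} : Finset ℕ), if (y.1 : ℕ) = (p * t + x.1) / 2 ∧ (y.2 : ℕ) = (q * t + x.2) / 2 then (1 / 2 : ℝ) * (if ab.1 then (-1 : ℝ) ^ ((p * t + x.1) % 2) else 1) * (if ab.2 then (-1 : ℝ) ^ ((q * t + x.2) % 2) else 1) else 0))).prod y ≠ 0 :=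
  fun _ _ hp hq hpq hp2 hq2 X hX v c T hT hex hx y hy =>
    full_of_exact_plain hp hq hpq hp2 hq2 _ rfl X hX v c T hT hex hx y hy

end Summit.QuantumAdvantage.QuantumAdvantage.Theorems.MobiusLadderQuadraticDigitPhasesStubNoExactA
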